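import Summits.AtomisticToContinuum.BoseEinsteinCondensation.Theorems.GaussianDominationCan.Negative.CruxForms
import Literature.MathematicalPhysics.QuantumManyBody.LangevinGenerator

/-!
# Crux `FibreConductance` in named vocabulary; fibre data of product states; Thomson duality

* `fibreW`, `fibrePsi`, `wave`, `fibreBeta`, `fibreCharge`, `IsFibreFlow`, `fibreCost` — the
  crux's `W, ψ, e^{ik·y}, β, q`, its weak-divergence clause and its cost, verbatim;
* fibre data of a real positive product state `Φ = φ^{⊗N}` (`∫φ² = 1`): `W = ∏_{j≠0}φ(xⱼ)²`,
  `ψ = φ(x₀)` exactly, `β ≡ β₀ = ∫ e_n φ`, `q = L^{-3/2}(e_n(x₀)φ(x₀) - β₀ φ(x₀)²)`,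
  cost weight `W/ψ² = ∏_{j≠0}φ(xⱼ)²/φ(x₀)²`;
* **Thomson duality** `norm_pairing_sq_le` (the calibration tool every line must respect): a fibre
  flow with weak divergence `q` satisfies `‖∫ q η‖² ≤ (∫|J|²w)(∫Σₗ|∂_{0,l}η|²/w)` for every `C¹`
  periodic test `η` and positive measurable weight `w` — Cauchy–Schwarz through the pairing,
  junk-proof (a non-integrable pairing has Bochner integral `0`; no measurability of `J` needed).

Crux disprover file for `stmt-AtomisticToContinuum-9480` (route `BECThomsonPrinciple`, crux
`FibreConductance`); part of the chain `Profiles → OneDimAxis → (FibreVocabulary) → SlabState →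
TestFunction → NearMinimiserFalse` proving `not_fibreConductanceNearMinimiser`: the exact-minimiser
hypothesis (H1) of the crux cannot be relaxed to `δ`-near-minimality for any `δ > 0`.
All [folklore] (elementary real analysis).
-/

noncomputable section

namespace Summit.AtomisticToContinuum.BoseEinsteinCondensation.Theorems.FibreConductance.Negative

open MeasureTheory Literature.MathematicalPhysics.QuantumManyBody.BoseGas
open scoped ENNReal NNReal

/-! ### Fibre data of a real product state -/

section ProductFibre

open Summit.AtomisticToContinuum.BoseEinsteinCondensation.Theorems.GaussianDominationCan.Negative

variable {m : ℕ} {L : ℝ}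

/-- The bath weight `W(X) = ∫_cell |φ(y, X̂)|² dy` (the crux's `W`). [folklore] -/
def fibreW (L : ℝ) (φ : Config (m + 1) → ℂ) (X : Config (m + 1)) : ℝ :=
  ∫ y in cell L, ‖φ (Function.update X 0 y)‖ ^ 2

/-- The conditional amplitude `ψ = |φ|/√W` of particle `0` given the bath (the crux's `ψ`). [folklore] -/
def fibrePsi (L : ℝ) (φ : Config (m + 1) → ℂ) (X : Config (m + 1)) : ℝ :=
  ‖φ X‖ / Real.sqrt (fibreW L φ X)

/-- The crux's one-body phase `e^{ik·y}`, `k = 2πn/L`, literally as typed. [folklore] -/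
def wave (L : ℝ) (n : Fin 3 → ℤ) (y : Space) : ℂ :=
  Complex.exp (Complex.I * ↑(2 * Real.pi / L * ∑ j, (n j : ℝ) * y j))

/-- `β(X̂) = ∫_cell e^{ik·y} ψ(y, X̂) dy` (the crux's `β`). [folklore] -/
def fibreBeta (L : ℝ) (n : Fin 3 → ℤ) (φ : Config (m + 1) → ℂ) (X : Config (m + 1)) : ℂ :=
  ∫ y in cell L, wave L n y * (fibrePsi L φ (Function.update X 0 y) : ℂ)

/-- The fibre-neutral charge `q = L^{-3/2}(e^{ik·x₀} ψ - β ψ²)` (the crux's `q`). [folklore] -/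
def fibreCharge (L : ℝ) (n : Fin 3 → ℤ) (φ : Config (m + 1) → ℂ) (X : Config (m + 1)) : ℂ :=
  ((Real.sqrt (L ^ 3))⁻¹ : ℂ) *
    (wave L n (X 0) * (fibrePsi L φ X : ℂ) - fibreBeta L n φ X * (fibrePsi L φ X : ℂ) ^ 2)

/-- `J` is a flow in the `x₀`-fibre with weak divergence `q` on the torus:
`∫ J·∇₀η = -∫ q η` for every `C¹`, `Lℤ³`-periodic `η` (the crux's first conjunct). [folklore] -/
def IsFibreFlow (m : ℕ) (L : ℝ) (q : Config (m + 1) → ℂ) (J : Config (m + 1) → Fin 3 → ℂ) : Prop :=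
  ∀ η : Config (m + 1) → ℂ, ContDiff ℝ 1 η →
    (∀ (X : Config (m + 1)) (i : Fin (m + 1)) (l : Fin 3),
      η (X + Pi.single i (EuclideanSpace.single l L)) = η X) →
    ∫ X in cellN (m + 1) L, ∑ l : Fin 3, J X l * fderiv ℝ η X (Pi.single 0 (EuclideanSpace.single l (1 : ℝ)))
      = - ∫ X in cellN (m + 1) L, q X * η X

/-- The bath-averaged fibre resistance (Thomson energy) `∫ |J|² W/ψ²` (the crux's cost). [folklore] -/
def fibreCost (L : ℝ) (φ : Config (m + 1) → ℂ) (J : Config (m + 1) → Fin 3 → ℂ) : ℝ≥0∞ :=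
  ∫⁻ X in cellN (m + 1) L, ENNReal.ofReal ((∑ l : Fin 3, ‖J X l‖ ^ 2) * fibreW L φ X / fibrePsi L φ X ^ 2)

/-- The crux's phase is the plane wave `e_n`. [folklore] -/
theorem wave_eq_cellWave (L : ℝ) (n : Fin 3 → ℤ) (y : Space) : wave L n y = cellWave L n y := by
  rw [wave, cellWave_apply]
  congr 1
  push_cast
  ring


/-- The real product state `Φ(X) = ∏ⱼ φ(xⱼ)` of a real one-body factor. [folklore] -/
def realProd (m : ℕ) (φ : Space → ℝ) : Config (m + 1) → ℂ :=
  prodFun fun _ : Fin (m + 1) => fun y => ((φ y : ℝ) : ℂ)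

/-- The bath factor `∏_{j ≠ 0} φ(xⱼ)²`. [folklore] -/
def bathProd (φ : Space → ℝ) (X : Config (m + 1)) : ℝ :=
  ∏ j ∈ Finset.univ.erase (0 : Fin (m + 1)), φ (X j) ^ 2

variable {φ : Space → ℝ}

/-- The bath factor of a positive profile is positive. [folklore] -/
theorem bathProd_pos (hφ : ∀ y, 0 < φ y) (X : Config (m + 1)) : 0 < bathProd φ X :=
  Finset.prod_pos fun _ _ => pow_pos (hφ _) 2

/-- `‖∏ φ(xⱼ)‖ = ∏ φ(xⱼ)` for a positive factor. [folklore] -/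
theorem norm_realProd (hφ : ∀ y, 0 < φ y) (X : Config (m + 1)) :
    ‖realProd m φ X‖ = ∏ j, φ (X j) := by
  unfold realProd prodFun
  rw [norm_prod]
  refine Finset.prod_congr rfl fun j _ => ?_
  rw [Complex.norm_real, Real.norm_of_nonneg (hφ _).le]

/-- `‖Φ(y, X̂)‖ = φ(y) ∏_{j≠0} φ(xⱼ)`. [folklore] -/
theorem norm_realProd_update (hφ : ∀ y, 0 < φ y) (X : Config (m + 1)) (y : Space) :
    ‖realProd m φ (Function.update X 0 y)‖ = φ y * ∏ j ∈ Finset.univ.erase (0 : Fin (m + 1)), φ (X j) := by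
  unfold realProd prodFun
  rw [prod_update_eq (fun _ : Fin (m + 1) => fun y => ((φ y : ℝ) : ℂ)) X 0 y, norm_mul, norm_prod,
    Complex.norm_real, Real.norm_of_nonneg (hφ _).le]
  congr 1
  refine Finset.prod_congr rfl fun j _ => ?_
  rw [Complex.norm_real, Real.norm_of_nonneg (hφ _).le]

/-- `‖Φ(X)‖ = φ(x₀) ∏_{j≠0} φ(xⱼ)`. [folklore] -/
theorem norm_realProd_eq_mul (hφ : ∀ y, 0 < φ y) (X : Config (m + 1)) :
    ‖realProd m φ X‖ = φ (X 0) * ∏ j ∈ Finset.univ.erase (0 : Fin (m + 1)), φ (X j) := by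
  have h := norm_realProd_update hφ X (X 0)
  rwa [Function.update_eq_self] at h

/-- `(∏_{j≠0} φ(xⱼ))² = bathProd φ X`. [folklore] -/
theorem prod_erase_sq (φ : Space → ℝ) (X : Config (m + 1)) :
    (∏ j ∈ Finset.univ.erase (0 : Fin (m + 1)), φ (X j)) ^ 2 = bathProd φ X := by
  unfold bathProd
  rw [← Finset.prod_pow]

/-- **`W` of a real product state**: `W(X) = ∏_{j≠0} φ(xⱼ)²` (with `∫φ² = 1`). [folklore] -/
theorem fibreW_realProd (hφ : ∀ y, 0 < φ y) (hn : ∫ y in cell L, φ y ^ 2 = 1) (X : Config (m + 1)) :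
    fibreW L (realProd m φ) X = bathProd φ X := by
  unfold fibreW
  simp_rw [norm_realProd_update hφ, mul_pow, prod_erase_sq]
  rw [integral_mul_const, hn, one_mul]

/-- **`ψ` of a real product state**: `ψ(X) = φ(x₀)`. [folklore] -/
theorem fibrePsi_realProd (hφ : ∀ y, 0 < φ y) (hn : ∫ y in cell L, φ y ^ 2 = 1) (X : Config (m + 1)) :
    fibrePsi L (realProd m φ) X = φ (X 0) := by
  unfold fibrePsi
  rw [fibreW_realProd hφ hn, norm_realProd_eq_mul hφ, ← prod_erase_sq,
    Real.sqrt_sq (Finset.prod_nonneg fun j _ => (hφ _).le), mul_div_assoc,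
    div_self (Finset.prod_pos fun j _ => hφ _).ne', mul_one]

/-- **`β` of a real product state**: the constant `β₀ = ∫_cell e_n φ`. [folklore] -/
theorem fibreBeta_realProd (hφ : ∀ y, 0 < φ y) (hn : ∫ y in cell L, φ y ^ 2 = 1) (n : Fin 3 → ℤ)
    (X : Config (m + 1)) :
    fibreBeta L n (realProd m φ) X = ∫ y in cell L, wave L n y * (φ y : ℂ) := by
  unfold fibreBeta
  refine setIntegral_congr_fun (measurableSet_cell L) fun y _ => ?_
  rw [fibrePsi_realProd hφ hn, Function.update_self]

/-- **`q` of a real product state**: `q(X) = L^{-3/2}(e_n(x₀)φ(x₀) - β₀ φ(x₀)²)`. [folklore] -/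
theorem fibreCharge_realProd (hφ : ∀ y, 0 < φ y) (hn : ∫ y in cell L, φ y ^ 2 = 1) (n : Fin 3 → ℤ)
    (X : Config (m + 1)) :
    fibreCharge L n (realProd m φ) X = ((Real.sqrt (L ^ 3))⁻¹ : ℂ) *
      (wave L n (X 0) * (φ (X 0) : ℂ) - (∫ y in cell L, wave L n y * (φ y : ℂ)) * (φ (X 0) : ℂ) ^ 2) := by
  unfold fibreCharge
  rw [fibrePsi_realProd hφ hn, fibreBeta_realProd hφ hn]

/-- The cost weight of a real product state: `W/ψ² = ∏_{j≠0}φ(xⱼ)² / φ(x₀)²`. [folklore] -/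
theorem fibreCost_realProd (hφ : ∀ y, 0 < φ y) (hn : ∫ y in cell L, φ y ^ 2 = 1)
    (J : Config (m + 1) → Fin 3 → ℂ) :
    fibreCost L (realProd m φ) J = ∫⁻ X in cellN (m + 1) L,
      ENNReal.ofReal ((∑ l : Fin 3, ‖J X l‖ ^ 2) * (bathProd φ X / φ (X 0) ^ 2)) := by
  unfold fibreCost
  refine lintegral_congr fun X => ?_
  rw [fibreW_realProd hφ hn, fibrePsi_realProd hφ hn, mul_div_assoc]

end ProductFibre

/-! ### Thomson duality: every fibre flow pays for every test function -/

section Duality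

variable {m : ℕ} {L : ℝ}

/-- `2a ≤ tK + D/t` for all `t > 0` forces `a² ≤ K D`. [folklore] -/
theorem sq_le_of_forall_two_mul_le {a K D : ℝ} (ha : 0 ≤ a) (hK : 0 ≤ K) (hD : 0 ≤ D)
    (h : ∀ t : ℝ, 0 < t → 2 * a ≤ t * K + D / t) : a ^ 2 ≤ K * D := by
  rcases ha.eq_or_lt with ha0 | ha0
  · rw [← ha0]; simp only [ne_eq, OfNat.ofNat_ne_zero, not_false_eq_true, zero_pow]; positivity
  rcases hD.eq_or_lt with hD0 | hD0
  · -- `D = 0`: `2a ≤ tK` for all small `t` forces `a = 0`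
    exfalso
    rcases hK.eq_or_lt with hK0 | hK0
    · have := h 1 one_pos
      rw [← hK0, ← hD0] at this
      simp at this
      linarith
    · have := h (a / K) (div_pos ha0 hK0)
      rw [← hD0, zero_div, add_zero, div_mul_cancel₀ _ hK0.ne'] at this
      linarith
  · have := h (D / a) (div_pos hD0 ha0)
    rw [div_div_cancel₀ hD0.ne'] at this
    have h2 : a ≤ D / a * K := by linarith
    have h3 : a * a ≤ D / a * K * a := mul_le_mul_of_nonneg_right h2 ha0.le
    have h4 : D / a * K * a = K * D := by field_simp
    nlinarith [h3, h4]

/-- Weighted Young inequality for a finite pairing: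
`‖Σ aₗbₗ‖ ≤ (c/2) Σ‖aₗ‖² + (1/2c) Σ‖bₗ‖²`. [folklore] -/
theorem norm_sum_mul_le_young {a b : Fin 3 → ℂ} {c : ℝ} (hc : 0 < c) :
    ‖∑ l, a l * b l‖ ≤ c / 2 * ∑ l, ‖a l‖ ^ 2 + 1 / (2 * c) * ∑ l, ‖b l‖ ^ 2 := by
  calc ‖∑ l, a l * b l‖ ≤ ∑ l, ‖a l * b l‖ := norm_sum_le _ _
    _ = ∑ l, ‖a l‖ * ‖b l‖ := by simp_rw [norm_mul]
    _ ≤ ∑ l, (c / 2 * ‖a l‖ ^ 2 + 1 / (2 * c) * ‖b l‖ ^ 2) := by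
        refine Finset.sum_le_sum fun l _ => ?_
        have h1 : 0 ≤ (c * ‖a l‖ - ‖b l‖) ^ 2 := sq_nonneg _
        have key : 2 * c * (‖a l‖ * ‖b l‖) ≤ c ^ 2 * ‖a l‖ ^ 2 + ‖b l‖ ^ 2 := by nlinarith [h1]
        rw [show c / 2 * ‖a l‖ ^ 2 + 1 / (2 * c) * ‖b l‖ ^ 2 =
          (c ^ 2 * ‖a l‖ ^ 2 + ‖b l‖ ^ 2) / (2 * c) by field_simp]
        rw [le_div_iff₀ (by positivity)]
        linarith
    _ = c / 2 * ∑ l, ‖a l‖ ^ 2 + 1 / (2 * c) * ∑ l, ‖b l‖ ^ 2 := by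
        rw [Finset.sum_add_distrib, Finset.mul_sum, Finset.mul_sum]

/-- The directional derivatives of a `C¹` function are continuous in the base point. [folklore] -/
theorem continuous_fderiv_apply_const {η : Config (m + 1) → ℂ} (hη : ContDiff ℝ 1 η)
    (v : Config (m + 1)) : Continuous fun X => fderiv ℝ η X v :=
  (ContinuousLinearMap.apply ℝ ℂ v).continuous.comp (hη.continuous_fderiv one_ne_zero)

/-- **Thomson duality (the disprover's calibration tool).** If `J` is a fibre flow with weak
divergence `q`, then for every `C¹` periodic test function `η`, every positive measurable
weight `w`, and real `K, D` with `∫ |J|² w ≤ K` and `∫ |∇₀η|²/w ≤ D`: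
`|∫ q η|² ≤ K · D`.  (Cauchy–Schwarz through the pairing `∫ J·∇₀η = -∫ qη`; junk-proof: a
non-integrable pairing has Bochner integral `0`.) [folklore] -/
theorem norm_pairing_sq_le {q : Config (m + 1) → ℂ} {J : Config (m + 1) → Fin 3 → ℂ}
    (hJ : IsFibreFlow m L q J) {η : Config (m + 1) → ℂ} (hη : ContDiff ℝ 1 η)
    (hper : ∀ (X : Config (m + 1)) (i : Fin (m + 1)) (l : Fin 3),
      η (X + Pi.single i (EuclideanSpace.single l L)) = η X)
    {w : Config (m + 1) → ℝ} (hw : ∀ X, 0 < w X) (hwm : Measurable w) {K D : ℝ} (hK : 0 ≤ K)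
    (hD : 0 ≤ D)
    (hcost : ∫⁻ X in cellN (m + 1) L, ENNReal.ofReal ((∑ l : Fin 3, ‖J X l‖ ^ 2) * w X) ≤
      ENNReal.ofReal K)
    (hdual : ∫⁻ X in cellN (m + 1) L, ENNReal.ofReal
      ((∑ l : Fin 3, ‖fderiv ℝ η X (Pi.single 0 (EuclideanSpace.single l (1 : ℝ)))‖ ^ 2) / w X) ≤
      ENNReal.ofReal D) :
    ‖∫ X in cellN (m + 1) L, q X * η X‖ ^ 2 ≤ K * D := by
  set F : Config (m + 1) → ℂ := fun X =>
    ∑ l : Fin 3, J X l * fderiv ℝ η X (Pi.single 0 (EuclideanSpace.single l (1 : ℝ))) with hF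
  have hpair : ∫ X in cellN (m + 1) L, F X = -∫ X in cellN (m + 1) L, q X * η X := hJ η hη hper
  have hnorm : ‖∫ X in cellN (m + 1) L, q X * η X‖ = ‖∫ X in cellN (m + 1) L, F X‖ := by
    rw [hpair, norm_neg]
  rw [hnorm]
  refine sq_le_of_forall_two_mul_le (norm_nonneg _) hK hD fun t ht => ?_
  -- pointwise Young bound
  set S₁ : Config (m + 1) → ℝ := fun X => (∑ l : Fin 3, ‖J X l‖ ^ 2) * w X
  set S₂ : Config (m + 1) → ℝ := fun X =>
    (∑ l : Fin 3, ‖fderiv ℝ η X (Pi.single 0 (EuclideanSpace.single l (1 : ℝ)))‖ ^ 2) / w X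
  have hpt : ∀ X, ‖F X‖ ≤ t / 2 * S₁ X + 1 / (2 * t) * S₂ X := by
    intro X
    have h := norm_sum_mul_le_young (a := fun l => J X l)
      (b := fun l => fderiv ℝ η X (Pi.single 0 (EuclideanSpace.single l (1 : ℝ))))
      (c := t * w X) (mul_pos ht (hw X))
    have e1 : t * w X / 2 * ∑ l : Fin 3, ‖J X l‖ ^ 2 = t / 2 * S₁ X := by
      simp only [S₁]; ring
    have e2 : 1 / (2 * (t * w X)) *
        ∑ l : Fin 3, ‖fderiv ℝ η X (Pi.single 0 (EuclideanSpace.single l (1 : ℝ)))‖ ^ 2 =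
        1 / (2 * t) * S₂ X := by
      simp only [S₂]
      have := (hw X).ne'
      field_simp
    rw [e1, e2] at h
    exact h
  have hS₁ : ∀ X, 0 ≤ S₁ X := fun X =>
    mul_nonneg (Finset.sum_nonneg fun l _ => by positivity) (hw X).le
  have hS₂ : ∀ X, 0 ≤ S₂ X := fun X =>
    div_nonneg (Finset.sum_nonneg fun l _ => by positivity) (hw X).le
  have hS₂m : Measurable fun X => ENNReal.ofReal (1 / (2 * t) * S₂ X) := by
    refine (Measurable.const_mul ?_ _).ennreal_ofReal
    refine Measurable.div (Finset.measurable_sum _ fun l _ => ?_) hwm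
    exact ((continuous_fderiv_apply_const hη _).norm.pow 2).measurable
  -- integrate
  have h1 : ‖∫ X in cellN (m + 1) L, F X‖ ≤
      (∫⁻ X in cellN (m + 1) L, ENNReal.ofReal ‖F X‖).toReal :=
    norm_integral_le_lintegral_norm F
  have h2 : ∫⁻ X in cellN (m + 1) L, ENNReal.ofReal ‖F X‖ ≤
      ENNReal.ofReal (t / 2) * ENNReal.ofReal K + ENNReal.ofReal (1 / (2 * t)) * ENNReal.ofReal D := by
    calc ∫⁻ X in cellN (m + 1) L, ENNReal.ofReal ‖F X‖
        ≤ ∫⁻ X in cellN (m + 1) L,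
            (ENNReal.ofReal (t / 2 * S₁ X) + ENNReal.ofReal (1 / (2 * t) * S₂ X)) := by
          refine lintegral_mono fun X => ?_
          rw [← ENNReal.ofReal_add (mul_nonneg (by positivity) (hS₁ X))
            (mul_nonneg (by positivity) (hS₂ X))]
          exact ENNReal.ofReal_le_ofReal (hpt X)
      _ = (∫⁻ X in cellN (m + 1) L, ENNReal.ofReal (t / 2 * S₁ X)) +
            ∫⁻ X in cellN (m + 1) L, ENNReal.ofReal (1 / (2 * t) * S₂ X) :=
          lintegral_add_right _ hS₂m
      _ = ENNReal.ofReal (t / 2) * (∫⁻ X in cellN (m + 1) L, ENNReal.ofReal (S₁ X)) +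
            ENNReal.ofReal (1 / (2 * t)) * ∫⁻ X in cellN (m + 1) L, ENNReal.ofReal (S₂ X) := by
          rw [← lintegral_const_mul' _ _ ENNReal.ofReal_ne_top,
            ← lintegral_const_mul' _ _ ENNReal.ofReal_ne_top]
          congr 1
          · refine lintegral_congr fun X => ?_
            rw [ENNReal.ofReal_mul (by positivity)]
          · refine lintegral_congr fun X => ?_
            rw [ENNReal.ofReal_mul (by positivity)]
      _ ≤ ENNReal.ofReal (t / 2) * ENNReal.ofReal K + ENNReal.ofReal (1 / (2 * t)) * ENNReal.ofReal D := by
          gcongr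
  have h3 : ENNReal.ofReal (t / 2) * ENNReal.ofReal K + ENNReal.ofReal (1 / (2 * t)) * ENNReal.ofReal D =
      ENNReal.ofReal (t / 2 * K + 1 / (2 * t) * D) := by
    rw [← ENNReal.ofReal_mul (by positivity), ← ENNReal.ofReal_mul (by positivity),
      ← ENNReal.ofReal_add (by positivity) (by positivity)]
  rw [h3] at h2
  have h4 := ENNReal.toReal_le_of_le_ofReal (by positivity) h2
  have h5 : ‖∫ X in cellN (m + 1) L, F X‖ ≤ t / 2 * K + 1 / (2 * t) * D := h1.trans h4
  have : t / 2 * K + 1 / (2 * t) * D = (t * K + D / t) / 2 := by field_simp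
  rw [this] at h5
  linarith

end Duality

end Summit.AtomisticToContinuum.BoseEinsteinCondensation.Theorems.FibreConductance.Negative

end
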